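import Summits.QuantumFields.YangMills.Theorems.AlphaInputsT3ACv3LinearLiftMatrixCLM
import HarnessLib

/-!
# `AlphaInputsT3ACv3LinearLiftMatrixSpread` — (V) THE MATRIX-VALUED PORT OF THE (LL) ENGINE, PART 7: the R4 LETTERS asked by ★w1 (LEAD, PROGRESS 7, 2026-08-28T01:18:20Z) —
# the matrix SPREAD `S1M`, the matrix COBOUNDARY POTENTIAL `psiIterM`, the matrix coboundary `dgradM`, ★★ the COBOUNDARY-DEFECT IDENTITY `Q₁^k(S1M Δ) = Δ − d(Ψ_k^M(S1M Δ))`,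
# their k-UNIFORM sup bounds WITHOUT `|n|²` (`‖S1M Ξ‖ ≤ 18^d‖Ξ‖∕L^k`, `‖Ψ_k^M(S1M Ξ)‖ ≤ (d∕2)·18^d·‖Ξ‖`), and the decomposition `liftSM = S1M + dgradM ∘ S0M ∘ psiIterM ∘ S1M` —
# cell `ym3-torus`, width seat `ym-ust-19936-w3` (g0); OWNER RULING g24-№4

WHY.  ★w1's contraction core (`…v3FLContractionCore.norm_defect_after_step_le`, row R6-core of memo v2.1 = 19936 evidence #57∕#58) abstracts the lift as the binder
`hT : ‖Q^(k)(U′−U)(c) − ((V(c) − Ū^(k)(c)) − (ψ(c₊)−ψ(c₋)))‖ ≤ τ`; row R4 instantiates it with `U′ := exp(S1M Δ)·U`, `ψ := psiIterM k (S1M Δ)` and needs, BY NAME: `S1M`, `psiIterM`,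
their sup bounds, and the LINEAR identity `Q₁^k (S1M Δ) = Δ − dψ` (the tree's scalar `dgrad_psiIter_S1_eq` of ★w2 g2 ∕ `linAvgIter_eq_segIter_sub` + `segIter_S1` of w2).  THIS FILE
(parts 1–2–5 supply `byEntry`, the `ℓ^∞` port `norm_byEntry_le_of_bound`, `linAvgIterM`, `liftSM`):
* §14 `dgradM` (matrix coboundary of a site field), `S0M k := byEntry (S0 k)`, `S1M k := byEntry (S1 k)`, `psiIterM k := byEntry (psiIter k)`; `byEntry_dgrad : byEntry dgrad = dgradM`;
  `byEntry_sub_op` (the port of a difference of operators); ★★ `linAvgIterM_S1M : linAvgIterM k (S1M k Δ) = Δ − dgradM (psiIterM k (S1M k Δ))`; ★ `liftSM_eq_S1M_add :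
  liftSM k A = S1M k A + dgradM (S0M k (psiIterM k (S1M k A)))` (w2 g2's `liftS` read entrywise); `curlM_S1M_eq_sum` (`curl ∘ S1M = S²`-spread of the coarse matrix curls).
* §15 the k-UNIFORM sup bounds, SAME constants as the scalar theorems (no `|n|²`): ★ `norm_S1M_le` (`≤ (18^d∕L^k)·M`), ★ `norm_S1M_le_local` (hypothesis on the `Near` cells of `b₋`
  only, ★w2 g2's `abs_S1_le_local`), `norm_S0M_le` (`≤ 18^d·M`), `norm_psiIterM_le` (`≤ ((d∕2)(L^s − 1))·M`), ★★ `norm_psiIterM_S1M_le` (`‖Ψ_k^M(S1M Ξ)(y)‖ ≤ ((d∕2)·18^d)·M` —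
  k-UNIFORM), `norm_dgradM_psiIterM_S1M_le` (`≤ (1 + (d+1)·18^d)·M`, ★w2 g2's `abs_dgrad_psiIter_S1_le` ported), `S1M_mem` ∕ `S0M_mem` ∕ `psiIterM_mem` (`𝔰𝔲(N)`-valuedness).
HONEST FRAMING.  Finite-dimensional real linear algebra; nothing of [Balaban1985UV3]∕[Balaban1985Variational]∕[Balaban1985Averaging] is asserted; (FL)∕`hLift`, the stub 2′χ, the crux
`HistoryTailL` and any gap are NOT claimed; count-neutral helper (`--supports stmt-QuantumFields-19936`); registry untouched.  YM₃ on the three-torus is a RUNG of the programme,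
not the Clay problem; nothing here is about d = 4, infinite volume or a mass gap.

References: T. Bałaban, Commun. Math. Phys. 109 (1987) 249–301 [Balaban1987RG1] ((0.3)–(0.4) pp.252–253, (0.11) p.253); Commun. Math. Phys. 98 (1985) 17–51 [Balaban1985Averaging]
((125) p.36); B. C. Hall, Lie Groups, Lie Algebras, and Representations (2015) [Hall2015] (Example 7.3).
-/

set_option autoImplicit false

noncomputable section

open scoped Matrix.Norms.L2Operator

namespace Summit.QuantumFields.YangMills.Theorems.LinearLiftMatrix

open Finset
open Literature.MathematicalPhysics.QuantumFieldTheory.Balaban1983to89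
open Literature.MathematicalPhysics.QuantumFieldTheory.Balaban1985CMP102.Setting
open Summit.QuantumFields.Balaban3D.Carriers
open Summit.QuantumFields.YangMills.Theorems.AbelianEML (linAvgIter curlAt)
open Summit.QuantumFields.YangMills.Theorems.LinearLiftGauge (dgrad psiIter)
open Summit.QuantumFields.YangMills.Theorems.LinearLiftProfile
open Summit.QuantumFields.YangMills.Theorems.LinearLiftSpread (hh S0 S1 S2 liftS Near weight_eq_zero_of_not_near near_self curlAt_S1 abs_S1_le_local dgrad_psiIter_S1_eq
  abs_dgrad_psiIter_S1_le S0L S0L_apply)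
open Summit.QuantumFields.YangMills.Theorems.LinearAvgSup (abs_S1_le abs_S0_le abs_psiIter_le')

/-! ## §14 The matrix spread, the matrix coboundary potential and the coboundary-defect identity -/

section Spread

variable {P : Params} {j : ℕ} {n : Type*}

/-- **THE MATRIX COBOUNDARY** of an `M_n(ℂ)`-valued site field: `(dΦ)(c) = Φ(c₊) − Φ(c₋)` (entrywise `LinearLiftGauge.dgrad`). [folklore] -/
def dgradM (Φ : Site P j → Matrix n n ℂ) : PBond P j → Matrix n n ℂ := fun c => Φ c.tgt - Φ c.src

/-- `dgradM` unfolded. [folklore] -/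
theorem dgradM_apply (Φ : Site P j → Matrix n n ℂ) (c : PBond P j) : dgradM Φ c = Φ c.tgt - Φ c.src := rfl

/-- **THE ENTRYWISE EXTENSION OF THE SCALAR COBOUNDARY IS THE MATRIX COBOUNDARY.** [folklore] -/
theorem byEntry_dgrad (Φ : Site P j → Matrix n n ℂ) : byEntry (dgrad : (Site P j → ℝ) → (PBond P j → ℝ)) Φ = dgradM Φ := by
  funext c; ext i l
  apply Complex.ext
  · rw [byEntry_apply_re]; simp [dgrad, dgradM]
  · rw [byEntry_apply_im]; simp [dgrad, dgradM]

/-- **THE PORT OF A DIFFERENCE OF OPERATORS** is the difference of the ports. [folklore] -/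
theorem byEntry_sub_op {ι κ : Type*} (T T' : (ι → ℝ) → (κ → ℝ)) (A : ι → Matrix n n ℂ) (b : κ) :
    byEntry (fun f => T f - T' f) A b = byEntry T A b - byEntry T' A b := by
  ext i l
  apply Complex.ext
  · simp [byEntry_apply_re, Matrix.sub_apply]
  · simp [byEntry_apply_im, Matrix.sub_apply]

/-- **THE MATRIX SPREAD OF A COARSE 0-FORM**: w2's `S0 k` on the real and imaginary part of every entry. [cite: Balaban1987RG1, (0.3) p.252 (bookkeeping)] -/
def S0M (k : ℕ) (Φ : Site P k → Matrix n n ℂ) : Site P 0 → Matrix n n ℂ := byEntry (S0 k) Φ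

/-- **THE MATRIX SPREAD OF A COARSE 1-FORM**: w2's `S1 k` on the real and imaginary part of every entry. [cite: Balaban1985Averaging, (125) p.36 (bookkeeping)] -/
def S1M (k : ℕ) (A : PBond P k → Matrix n n ℂ) : PBond P 0 → Matrix n n ℂ := byEntry (S1 k) A

/-- **THE MATRIX COBOUNDARY POTENTIAL** `Ψ_k^M`: w2's `psiIter k` on the real and imaginary part of every entry. [cite: Balaban1987RG1, (0.4) p.253 (bookkeeping)] -/
def psiIterM (k : ℕ) (a : PBond P 0 → Matrix n n ℂ) : Site P k → Matrix n n ℂ := byEntry (psiIter k) a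

/-- `S0M k = byEntry (S0 k)`. [folklore] -/
theorem S0M_eq (k : ℕ) (Φ : Site P k → Matrix n n ℂ) : S0M k Φ = byEntry (S0 k) Φ := rfl

/-- `S1M k = byEntry (S1 k)`. [folklore] -/
theorem S1M_eq (k : ℕ) (A : PBond P k → Matrix n n ℂ) : S1M k A = byEntry (S1 k) A := rfl

/-- `psiIterM k = byEntry (psiIter k)`. [folklore] -/
theorem psiIterM_eq (k : ℕ) (a : PBond P 0 → Matrix n n ℂ) : psiIterM k a = byEntry (psiIter k) a := rfl

variable (k : ℕ) (hk : k ≤ P.m + P.K)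
include hk

/-- **★★ THE COBOUNDARY-DEFECT IDENTITY IN MATRIX CURRENCY (R4's `hT` main term)**: `linAvgIterM k (S1M k Δ) = Δ − dgradM (psiIterM k (S1M k Δ))` — the `k`-fold MATRIX linearised
(0.4) average of the matrix spread is the datum minus the coboundary of the matrix potential (★w2 g2's scalar `dgrad_psiIter_S1_eq` ∕ w2's `linAvgIter_eq_segIter_sub` + `segIter_S1`,
read entrywise). [cite: Balaban1987RG1, (0.4)+(0.11) p.253] -/
theorem linAvgIterM_S1M [Fintype n] [DecidableEq n] [Nonempty n] (Δ : PBond P k → Matrix n n ℂ) :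
    linAvgIterM k (S1M k Δ) = Δ - dgradM (psiIterM k (S1M k Δ)) := by
  have hscal : ∀ f : PBond P k → ℝ, (linAvgIter k ∘ S1 k) f = (fun g => g - (dgrad ∘ psiIter k ∘ S1 k) g) f := fun f => by
    simp only [Function.comp]
    rw [dgrad_psiIter_S1_eq k hk f]
    abel
  have e1 : byEntry (fun g : PBond P k → ℝ => g) Δ = Δ := byEntry_id Δ
  have e2 : byEntry (dgrad ∘ psiIter k ∘ S1 k) Δ = dgradM (psiIterM k (S1M k Δ)) := by
    rw [← byEntry_dgrad, psiIterM_eq, S1M_eq, byEntry_comp, byEntry_comp]; rfl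
  funext c
  rw [Pi.sub_apply, ← e2, ← congrFun e1 c, linAvgIterM_eq_byEntry, S1M_eq, byEntry_comp, byEntry_congr hscal, byEntry_sub_op]

omit hk in
/-- **★ w2 g2's SUP-SMALL LIFT READ ENTRYWISE**: `liftSM k A = S1M k A + dgradM (S0M k (psiIterM k (S1M k A)))` (`liftS k A = S1 k A + d(S0 (Ψ_k (S1 k A)))`).
[cite: Balaban1987RG1, (0.4)+(0.11) p.253] -/
theorem liftSM_eq_S1M_add (A : PBond P k → Matrix n n ℂ) : liftSM k A = fun b => S1M k A b + dgradM (S0M k (psiIterM k (S1M k A))) b := by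
  funext b; ext i l
  apply Complex.ext
  · rw [liftSM_eq, byEntry_apply_re, Matrix.add_apply, Complex.add_re]
    simp only [liftS, Pi.add_apply, S1M_eq, byEntry_apply_re, dgradM_apply, Matrix.sub_apply, Complex.sub_re, S0M_eq, psiIterM_eq, dgrad]
  · rw [liftSM_eq, byEntry_apply_im, Matrix.add_apply, Complex.add_im]
    simp only [liftS, Pi.add_apply, S1M_eq, byEntry_apply_im, dgradM_apply, Matrix.sub_apply, Complex.sub_im, S0M_eq, psiIterM_eq, dgrad]

/-- **THE MATRIX CURL OF THE MATRIX SPREAD IS THE `S²`-SPREAD OF THE COARSE MATRIX CURLS** (entrywise `curlAt_S1`). [cite: Balaban1987RG1, (0.4) p.253] -/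
theorem curlM_S1M_eq_sum (A : PBond P k → Matrix n n ℂ) (x : Site P 0) {μ ν : Fin P.d} (hμν : μ ≠ ν) :
    curlM (S1M k A) x μ ν = ∑ y, (wS2 k x μ ν y) • curlM A y μ ν := by
  ext i l
  apply Complex.ext
  · rw [curlM_apply_re, Matrix.sum_apply, Complex.re_sum]
    have h : (fun b => (S1M k A b i l).re) = S1 k (fun c => (A c i l).re) := funext fun b => byEntry_apply_re _ _ _ _ _
    rw [h, curlAt_S1 k hk _ x hμν, S2_eq_sum_wS2]
    refine sum_congr rfl fun y _ => ?_
    rw [Matrix.smul_apply, Complex.smul_re, smul_eq_mul, curlM_apply_re]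
  · rw [curlM_apply_im, Matrix.sum_apply, Complex.im_sum]
    have h : (fun b => (S1M k A b i l).im) = S1 k (fun c => (A c i l).im) := funext fun b => byEntry_apply_im _ _ _ _ _
    rw [h, curlAt_S1 k hk _ x hμν, S2_eq_sum_wS2]
    refine sum_congr rfl fun y _ => ?_
    rw [Matrix.smul_apply, Complex.smul_im, smul_eq_mul, curlM_apply_im]

end Spread

/-! ## §15 The k-uniform sup bounds, same constants as the scalar theorems -/

section Bounds

variable {P : Params} {n : Type*} [Fintype n] [DecidableEq n] (k : ℕ)

/-- **★ `‖S1M k Ξ (b)‖ ≤ (18^d ∕ L^k)·M`** when `‖Ξ c‖ ≤ M` (w1's `abs_S1_le` ported — no `|n|²`). [cite: Balaban1985Averaging, (125) p.36 (bookkeeping)] -/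
theorem norm_S1M_le (Ξ : PBond P k → Matrix n n ℂ) {M : ℝ} (hΞ : ∀ c, ‖Ξ c‖ ≤ M) (b : PBond P 0) : ‖S1M k Ξ b‖ ≤ ((18 : ℝ) ^ P.d / (P.L : ℝ) ^ k) * M := by
  classical
  have hM : 0 ≤ M := (norm_nonneg _).trans (hΞ ⟨fun _ => 0, b.dir⟩)
  rw [S1M_eq, byEntry_congr (T := S1 k) (fun f => (S1L_apply k f).symm)]
  refine norm_byEntry_le_of_bound (S1L P k) (fun _ => True) b (fun f M' hf => ?_) Ξ hM fun c _ => hΞ c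
  have h := abs_S1_le k f (fun c => hf c trivial) b
  calc |S1L P k f b| = |S1 k f b| := rfl
    _ ≤ (18 : ℝ) ^ P.d * M' / (P.L : ℝ) ^ k := h
    _ = (18 : ℝ) ^ P.d / (P.L : ℝ) ^ k * M' := by ring

/-- **★ THE LOCAL FORM**: `‖S1M k Ξ (b)‖ ≤ (18^d ∕ L^k)·M` as soon as `‖Ξ(y, μ_b)‖ ≤ M` at the coarse `y` NEAR `b₋` (★w2 g2's `abs_S1_le_local` ported; standing range).
[cite: Balaban1985Averaging, (125) p.36 (bookkeeping)] -/
theorem norm_S1M_le_local (hk : k ≤ P.m + P.K) (Ξ : PBond P k → Matrix n n ℂ) (b : PBond P 0) {M : ℝ} (hΞ : ∀ y : Site P k, Near k b.src y → ‖Ξ ⟨y, b.dir⟩‖ ≤ M) :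
    ‖S1M k Ξ b‖ ≤ ((18 : ℝ) ^ P.d / (P.L : ℝ) ^ k) * M := by
  classical
  have hM : 0 ≤ M := (norm_nonneg _).trans (hΞ _ (near_self k hk b.src))
  rw [S1M_eq, byEntry_congr (T := S1 k) (fun f => (S1L_apply k f).symm)]
  refine norm_byEntry_le_of_bound (S1L P k) (fun c : PBond P k => Near k b.src c.src ∧ c.dir = b.dir) b (fun f M' hf => ?_) Ξ hM fun c hc => ?_
  · have h := abs_S1_le_local k hk f b (M := M') fun y hy => hf ⟨y, b.dir⟩ ⟨hy, rfl⟩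
    calc |S1L P k f b| = |S1 k f b| := rfl
      _ ≤ (18 : ℝ) ^ P.d * M' / (P.L : ℝ) ^ k := h
      _ = (18 : ℝ) ^ P.d / (P.L : ℝ) ^ k * M' := by ring
  · obtain ⟨hc1, hc2⟩ := hc
    have : c = ⟨c.src, b.dir⟩ := by rw [← hc2]
    rw [this]; exact hΞ c.src hc1

/-- **`‖S0M k Φ (x)‖ ≤ 18^d·M`** when `‖Φ y‖ ≤ M` (w1's `abs_S0_le` ported). [cite: Balaban1987RG1, (0.3) p.252 (bookkeeping)] -/
theorem norm_S0M_le (Φ : Site P k → Matrix n n ℂ) {M : ℝ} (hM : 0 ≤ M) (hΦ : ∀ y, ‖Φ y‖ ≤ M) (x : Site P 0) : ‖S0M k Φ x‖ ≤ (18 : ℝ) ^ P.d * M := by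
  classical
  rw [S0M_eq, byEntry_congr (T := S0 k) (fun f => (S0L_apply k f).symm)]
  exact norm_byEntry_le_of_bound (S0L P k) (fun _ => True) x (fun f M' hf => abs_S0_le k f (fun y => hf y trivial) x) Φ hM fun y _ => hΦ y

/-- **`‖psiIterM s a (y)‖ ≤ ((d∕2)(L^s − 1))·M`** when `‖a b‖ ≤ M` (w1's `abs_psiIter_le'` ported). [cite: Balaban1987RG1, (0.4) p.253 (bookkeeping)] -/
theorem norm_psiIterM_le (s : ℕ) (a : PBond P 0 → Matrix n n ℂ) {M : ℝ} (hM : 0 ≤ M) (ha : ∀ b, ‖a b‖ ≤ M) (y : Site P s) :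
    ‖psiIterM s a y‖ ≤ ((P.d : ℝ) / 2 * ((P.L : ℝ) ^ s - 1)) * M := by
  classical
  rw [psiIterM_eq, byEntry_congr (T := psiIter s) (fun f => (psiIterL_apply s f).symm)]
  exact norm_byEntry_le_of_bound (psiIterL P s) (fun _ => True) y (fun f M' hf => abs_psiIter_le' f (fun b => hf b trivial) s y) a hM fun b _ => ha b

/-- **★★ THE k-UNIFORM BOUND OF THE MATRIX POTENTIAL OF A SPREAD**: `‖Ψ_k^M (S1M k Ξ)(y)‖ ≤ ((d∕2)·18^d)·M` when `‖Ξ c‖ ≤ M` — the `L^k` of `Ψ_k` against the `L^{−k}` of the spread.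
[cite: Balaban1987RG1, (0.4)+(0.11) p.253] -/
theorem norm_psiIterM_S1M_le (Ξ : PBond P k → Matrix n n ℂ) {M : ℝ} (hΞ : ∀ c, ‖Ξ c‖ ≤ M) (y : Site P k) :
    ‖psiIterM k (S1M k Ξ) y‖ ≤ ((P.d : ℝ) / 2 * (18 : ℝ) ^ P.d) * M := by
  have hM : 0 ≤ M := (norm_nonneg _).trans (hΞ ⟨fun _ => 0, ⟨0, P.hd⟩⟩)
  have hL1 : (1 : ℝ) ≤ (P.L : ℝ) ^ k := one_le_pow₀ (by exact_mod_cast P.L_pos)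
  have hLk : (0 : ℝ) < (P.L : ℝ) ^ k := by positivity
  have h1 : ∀ b, ‖S1M k Ξ b‖ ≤ ((18 : ℝ) ^ P.d / (P.L : ℝ) ^ k) * M := fun b => norm_S1M_le k Ξ hΞ b
  have h := norm_psiIterM_le k (S1M k Ξ) (by positivity) h1 y
  refine h.trans ?_
  have hd : (0 : ℝ) ≤ P.d := Nat.cast_nonneg _
  have key : ((P.L : ℝ) ^ k - 1) * ((18 : ℝ) ^ P.d / (P.L : ℝ) ^ k) ≤ (18 : ℝ) ^ P.d := by
    rw [← mul_div_assoc, div_le_iff₀ hLk]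
    nlinarith [pow_nonneg (show (0 : ℝ) ≤ 18 by norm_num) P.d]
  calc (P.d : ℝ) / 2 * ((P.L : ℝ) ^ k - 1) * (((18 : ℝ) ^ P.d / (P.L : ℝ) ^ k) * M)
      = (P.d : ℝ) / 2 * ((((P.L : ℝ) ^ k - 1) * ((18 : ℝ) ^ P.d / (P.L : ℝ) ^ k)) * M) := by ring
    _ ≤ (P.d : ℝ) / 2 * ((18 : ℝ) ^ P.d * M) := by
        exact mul_le_mul_of_nonneg_left (mul_le_mul_of_nonneg_right key hM) (by positivity)
    _ = ((P.d : ℝ) / 2 * (18 : ℝ) ^ P.d) * M := by ring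

/-- **THE COBOUNDARY DEFECT OF THE MATRIX SPREAD IS `O(M)`, k-UNIFORM**: `‖dgradM (psiIterM k (S1M k Ξ)) c‖ ≤ (1 + (d+1)·18^d)·M` (★w2 g2's `abs_dgrad_psiIter_S1_le` ported
through `byEntry_dgrad`). [cite: Balaban1985Averaging, (125) p.36 (bookkeeping)] -/
theorem norm_dgradM_psiIterM_S1M_le (hk : k ≤ P.m + P.K) (Ξ : PBond P k → Matrix n n ℂ) {M : ℝ} (hΞ : ∀ c, ‖Ξ c‖ ≤ M) (c : PBond P k) :
    ‖dgradM (psiIterM k (S1M k Ξ)) c‖ ≤ (1 + ((P.d : ℝ) + 1) * (18 : ℝ) ^ P.d) * M := by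
  classical
  have hM : 0 ≤ M := (norm_nonneg _).trans (hΞ c)
  have hfun : dgradM (psiIterM k (S1M k Ξ)) = byEntry (dgrad ∘ psiIter k ∘ S1 k) Ξ := by
    rw [← byEntry_dgrad, psiIterM_eq, S1M_eq, byEntry_comp, byEntry_comp]; rfl
  have hlin : ∀ f, (dgrad ∘ psiIter k ∘ S1 k) f = ((LinearMap.id : (PBond P k → ℝ) →ₗ[ℝ] (PBond P k → ℝ)) - (linAvgIterL P k).comp (S1L P k)) f := fun f => by
    simp only [Function.comp, LinearMap.sub_apply, LinearMap.id_apply, LinearMap.comp_apply, linAvgIterL_apply, S1L_apply]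
    exact dgrad_psiIter_S1_eq k hk f
  rw [hfun, byEntry_congr hlin]
  refine norm_byEntry_le_of_bound _ (fun _ => True) c (fun f M' hf => ?_) Ξ hM fun c' _ => hΞ c'
  have h := abs_dgrad_psiIter_S1_le k hk f (fun c' => hf c' trivial) c
  rw [dgrad_psiIter_S1_eq k hk f] at h
  simpa [LinearMap.sub_apply, linAvgIterL_apply, S1L_apply] using h

omit [Fintype n] [DecidableEq n] in
/-- `S1M` maps `S`-valued data to `S`-valued fields (any `ℝ`-submodule, e.g. `𝔰𝔲(N)`). [cite: Hall2015, Example 7.3] -/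
theorem S1M_mem (S : Submodule ℝ (Matrix n n ℂ)) {Ξ : PBond P k → Matrix n n ℂ} (hΞ : ∀ c, Ξ c ∈ S) (b : PBond P 0) : S1M k Ξ b ∈ S := by
  classical
  rw [S1M_eq, byEntry_congr (T := S1 k) (fun f => (S1L_apply k f).symm)]
  exact byEntry_mem (S1L P k) S hΞ b

omit [Fintype n] [DecidableEq n] in
/-- `S0M` maps `S`-valued data to `S`-valued fields. [cite: Hall2015, Example 7.3] -/
theorem S0M_mem (S : Submodule ℝ (Matrix n n ℂ)) {Φ : Site P k → Matrix n n ℂ} (hΦ : ∀ y, Φ y ∈ S) (x : Site P 0) : S0M k Φ x ∈ S := by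
  classical
  rw [S0M_eq, byEntry_congr (T := S0 k) (fun f => (S0L_apply k f).symm)]
  exact byEntry_mem (S0L P k) S hΦ x

omit [Fintype n] [DecidableEq n] in
/-- `psiIterM` maps `S`-valued fields to `S`-valued potentials. [cite: Hall2015, Example 7.3] -/
theorem psiIterM_mem (s : ℕ) (S : Submodule ℝ (Matrix n n ℂ)) {a : PBond P 0 → Matrix n n ℂ} (ha : ∀ b, a b ∈ S) (y : Site P s) : psiIterM s a y ∈ S := by
  classical
  rw [psiIterM_eq, byEntry_congr (T := psiIter s) (fun f => (psiIterL_apply s f).symm)]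
  exact byEntry_mem (psiIterL P s) S ha y

end Bounds

end Summit.QuantumFields.YangMills.Theorems.LinearLiftMatrix

end
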